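import Mathlib
import Summits.ValiantsHypothesis.ValiantsHypothesis.Theorems.FifoMatchingNNDivisionHardSplitFaceAvoiding
import Summits.ValiantsHypothesis.ValiantsHypothesis.Theorems.FifoMatchingNNDivisionHardFewArcsAvoidable
import HarnessLib

/-!
# Route FifoMatching — crux `NNDivisionHard` (stmt-ValiantsHypothesis-21181): FACES AVOIDING A BOUNDED NUMBER OF ARBITRARY
# ARCS ARE HARD — the block recursion, run; cofactors generic for SOME arc set of bounded size are not certificates

The block recursion for avoiding faces (`…SplitFaceAvoiding.complexity_faceL_le / _faceR_le`: one step costs `+3`, removes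
every arc crossing the boundary and every arc inside the discarded block, the latter at the price of one avoiding matching
there — supplied by `…FewArcsAvoidable.exists_nestFree_avoiding_of_card_le`) is run to the end: at each step the boundary is
placed next to one arc `A` of `I` (below `A.2` keeping the left block if `A` ends in the right half, above `A.1` keeping the
right block otherwise), so the kept block has half size `≥ (n − 2)/2 − O(k)` and loses `A`.  After `|I| ≤ k` steps the face is a
full `NN_m`, `m ≥ n / 2^{k} − O(1)`, hard by `NNMonotoneExpBound.exp_lower_bound`.

* ★★ `fewArcFaces_exp_lower_bound` — **for every `k` there are `n₀, C` with: for all `n ≥ n₀` and every set `I` of at most `k`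
  arc variables of `[0, 2n)` there is `m`, `n ≤ C (m + 1)`, with `2^{m^{1/6}} ≤ L₊(NN_n^{¬I}) + 3k`;**
* ★★ `fewArcFaces_qp_hard` — quasi-polynomial currency: `L₊(NN_n^{¬I}) ≤ 16((2n+1)(L+2))² ⇒ 2^((log₂ n + c)^c) < L`;
* ★★ `fewArcsGeneric_not_certificate_qp` — **for every `k, c`, eventually in `n`: every cofactor `h` whose outer face
  `top_{𝟙_{I^c}} h` is a single monomial for SOME set `I` of at most `k` arcs satisfies
  `2^((log₂ n + c)^c) < L₊(NN_n · h) + L₊(h)`** — in particular every positive power sum `(Σ_{M ∈ 𝓜} c_M x^M)^D` of at most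
  `k + 1` perfect matchings one of which is nest-free (`…ShortArcGeneric.powerSum…` pattern with `I` = one separating arc per
  competitor), for EVERY degree `D`, with no shortness / stabbing condition on the separating arcs.

HONEST FRAMING: the «bounded separating set» genericity tier for ONE candidate; symmetric sums (all small-set outer faces
with ≥ 2 terms) untouched; stmt-21181 OPEN; nothing here bears on `NNNotVP` / VP ≠ VNP.  No definitions, no named facts.
References: [HrubesYehudayoff2021] §6 Pb 2; [Burgisser2000] Rem. 2.7; [ChenDengDuStanleyYan2007] §1.
-/

noncomputable section

-- Sub = Summit single-conjunct layout: the duplicated namespace component is mandated by the tree.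
set_option linter.dupNamespace false
set_option autoImplicit false

namespace Summit.ValiantsHypothesis.ValiantsHypothesis.Theorems.FifoMatching.NNDivisionHard.FewArcFaces

open Finset MvPolynomial Literature.Computability.AlgebraicComplexity
open Summit.ValiantsHypothesis.ValiantsHypothesis.Theorems.ZeroOneTransfer.Negative (topComponent)
open Summit.ValiantsHypothesis.ValiantsHypothesis.Theorems.FifoMatching.NNDivisionHard.StackPowersQueue
  (blockEmb blockEmb_injective)
open Summit.ValiantsHypothesis.ValiantsHypothesis.Theorems.FifoMatching.NNDivisionHard.SplitFace
  (shiftR blockEmbR two_mul_le val_shiftR blockEmbR_injective)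
open Summit.ValiantsHypothesis.ValiantsHypothesis.Theorems.FifoMatching.NNDivisionHard.ArcElimination
  (complexity_avoidingFace_le_of_top_monomial)
open Summit.ValiantsHypothesis.ValiantsHypothesis.Theorems.FifoMatching.NNDivisionHard.BinomialPowers
  (absorb_arith absorb_exp)
open Summit.ValiantsHypothesis.ValiantsHypothesis.Theorems.FifoMatching.NNDivisionHard.SplitFaceAvoiding
  (complexity_faceL_le complexity_faceR_le)
open Summit.ValiantsHypothesis.ValiantsHypothesis.Theorems.FifoMatching.NNDivisionHard.FewArcsAvoidable
  (exists_nestFree_avoiding_of_card_le)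
open scoped NNReal BigOperators

/-! ### §1 Asymptotics: polylog against a root of a linear fraction -/

/-- `(log₂ n + K)^K < m^{1/6}` eventually, uniformly in `n ≤ C (m + 1)`. [folklore] -/
theorem polylog_lt_rpow_lin_eventually (K C : ℕ) : ∃ n₀ : ℕ, ∀ n : ℕ, n₀ ≤ n → ∀ m : ℕ, n ≤ C * (m + 1) →
    (((Nat.log 2 n + K) ^ K : ℕ) : ℝ) < (m : ℝ) ^ ((1 : ℝ) / 6) := by
  set e : ℕ := Nat.log 2 C + 1 with he
  have hCe : C < 2 ^ e := Nat.lt_pow_succ_log_self one_lt_two C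
  obtain ⟨n₂, hn₂⟩ := CorSandwich.polylog_lt_rpow_eventually (K + e + 2) (c := 1 / 6) (by norm_num)
  refine ⟨C * (n₂ + 2) + 1, fun n hn m hm => ?_⟩
  have hCpos : 0 < C := by
    rcases Nat.eq_zero_or_pos C with h0 | h0
    · rw [h0] at hm hn; omega
    · exact h0
  have hm2 : n₂ + 2 ≤ m + 1 := by
    by_contra hlt
    push Not at hlt
    have : C * (m + 1) ≤ C * (n₂ + 1) := Nat.mul_le_mul_left C (by omega)
    have : C * (n₂ + 2) = C * (n₂ + 1) + C := by ring
    omega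
  have hm1 : 1 ≤ m := by omega
  have h := hn₂ m (by omega)
  -- `log₂ n ≤ log₂ m + e + 1`
  have hlt : n < 2 ^ (Nat.log 2 m + e + 2) := by
    have h1 : m < 2 ^ (Nat.log 2 m + 1) := Nat.lt_pow_succ_log_self one_lt_two m
    have h3 : C * (m + 1) ≤ C * (2 * m) := Nat.mul_le_mul_left C (by omega)
    have h4 : C * (2 * m) < 2 ^ e * (2 * m) := mul_lt_mul_of_pos_right hCe (by omega)
    have h5 : 2 ^ e * (2 * m) ≤ 2 ^ e * (2 * 2 ^ (Nat.log 2 m + 1)) := Nat.mul_le_mul_left _ (by omega)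
    have h6 : 2 ^ e * (2 * 2 ^ (Nat.log 2 m + 1)) = 2 ^ (Nat.log 2 m + e + 2) := by ring
    calc n ≤ C * (m + 1) := hm
      _ ≤ C * (2 * m) := h3
      _ < 2 ^ e * (2 * m) := h4
      _ ≤ 2 ^ e * (2 * 2 ^ (Nat.log 2 m + 1)) := h5
      _ = 2 ^ (Nat.log 2 m + e + 2) := h6
  have hlog : Nat.log 2 n < Nat.log 2 m + e + 2 := Nat.log_lt_of_lt_pow' (by omega) hlt
  have hle : (Nat.log 2 n + K) ^ K ≤ (Nat.log 2 m + (K + e + 2)) ^ (K + e + 2) :=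
    calc (Nat.log 2 n + K) ^ K ≤ (Nat.log 2 m + (K + e + 2)) ^ K := Nat.pow_le_pow_left (by omega) K
      _ ≤ (Nat.log 2 m + (K + e + 2)) ^ (K + e + 2) := Nat.pow_le_pow_right (by omega) (by omega)
  exact lt_of_le_of_lt (by exact_mod_cast hle) h

/-! ### §2 Arc counts in the blocks -/

section Blocks

variable {b c : ℕ}

/-- The left-internal arcs of `I` are at most `|I|`. [folklore] -/
theorem card_preimageL_le (I : Finset (Fin (2 * (b + c)) × Fin (2 * (b + c)))) :
    ((Finset.univ : Finset (Fin (2 * b) × Fin (2 * b))).filter (fun a => blockEmb (two_mul_le b c) a ∈ I)).card ≤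
      I.card :=
  Finset.card_le_card_of_injOn (blockEmb (two_mul_le b c)) (fun _ ha => (Finset.mem_filter.1 ha).2)
    ((blockEmb_injective (two_mul_le b c)).injOn)

/-- The right-internal arcs of `I` are at most `|I|`. [folklore] -/
theorem card_preimageR_le (I : Finset (Fin (2 * (b + c)) × Fin (2 * (b + c)))) :
    ((Finset.univ : Finset (Fin (2 * c) × Fin (2 * c))).filter (fun a => blockEmbR b c a ∈ I)).card ≤ I.card :=
  Finset.card_le_card_of_injOn (blockEmbR b c) (fun _ ha => (Finset.mem_filter.1 ha).2) (blockEmbR_injective.injOn)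

/-- If some arc `A ∈ I` is not left-internal (`2b ≤ A.2`), the left-internal arcs are at most `|I| − 1`. [folklore] -/
theorem card_preimageL_le_pred (I : Finset (Fin (2 * (b + c)) × Fin (2 * (b + c)))) {A : Fin (2 * (b + c)) × Fin (2 * (b + c))}
    (hA : A ∈ I) (hA2 : 2 * b ≤ (A.2 : ℕ)) :
    ((Finset.univ : Finset (Fin (2 * b) × Fin (2 * b))).filter (fun a => blockEmb (two_mul_le b c) a ∈ I)).card ≤
      I.card - 1 := by
  rw [← Finset.card_erase_of_mem hA]
  refine Finset.card_le_card_of_injOn (blockEmb (two_mul_le b c)) (fun a ha => ?_)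
    ((blockEmb_injective (two_mul_le b c)).injOn)
  refine Finset.mem_erase.2 ⟨fun h => ?_, (Finset.mem_filter.1 ha).2⟩
  have := congrArg (fun p => ((p.2 : Fin (2 * (b + c))) : ℕ)) h
  simp only [blockEmb, Prod.map_snd, Fin.val_castLE] at this
  have := a.2.isLt
  omega

/-- If some arc `A ∈ I` is not right-internal (`A.1 < 2b`), the right-internal arcs are at most `|I| − 1`. [folklore] -/
theorem card_preimageR_le_pred (I : Finset (Fin (2 * (b + c)) × Fin (2 * (b + c)))) {A : Fin (2 * (b + c)) × Fin (2 * (b + c))}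
    (hA : A ∈ I) (hA1 : (A.1 : ℕ) < 2 * b) :
    ((Finset.univ : Finset (Fin (2 * c) × Fin (2 * c))).filter (fun a => blockEmbR b c a ∈ I)).card ≤ I.card - 1 := by
  rw [← Finset.card_erase_of_mem hA]
  refine Finset.card_le_card_of_injOn (blockEmbR b c) (fun a ha => ?_) (blockEmbR_injective.injOn)
  refine Finset.mem_erase.2 ⟨fun h => ?_, (Finset.mem_filter.1 ha).2⟩
  have := congrArg (fun p => ((p.1 : Fin (2 * (b + c))) : ℕ)) h
  simp only [blockEmbR, Prod.map_fst, val_shiftR] at this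
  omega

/-- LEFT STEP in preimage form. [cite: Burgisser2000, Rem. 2.7] -/
theorem stepL (I : Finset (Fin (2 * (b + c)) × Fin (2 * (b + c))))
    (hL : ∃ NL ∈ nestFreeMatchings (2 * b), ∀ j ∈ openers NL, (j, NL j) ∉
      (Finset.univ : Finset (Fin (2 * b) × Fin (2 * b))).filter (fun a => blockEmb (two_mul_le b c) a ∈ I))
    (hR : ∃ NR ∈ nestFreeMatchings (2 * c), ∀ j ∈ openers NR, (j, NR j) ∉
      (Finset.univ : Finset (Fin (2 * c) × Fin (2 * c))).filter (fun a => blockEmbR b c a ∈ I)) :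
    complexity (∑ NL ∈ (nestFreeMatchings (2 * b)).filter (fun NL => ∀ j ∈ openers NL, (j, NL j) ∉
        (Finset.univ : Finset (Fin (2 * b) × Fin (2 * b))).filter (fun a => blockEmb (two_mul_le b c) a ∈ I)),
        arcMonomial ℝ≥0 NL) ≤
      complexity (∑ M ∈ (nestFreeMatchings (2 * (b + c))).filter (fun M => ∀ j ∈ openers M, (j, M j) ∉ I),
        arcMonomial ℝ≥0 M) + 3 := by
  classical
  have hfL : ∀ NL : Fin (2 * b) → Fin (2 * b), (∀ j ∈ openers NL, blockEmb (two_mul_le b c) (j, NL j) ∉ I) ↔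
      (∀ j ∈ openers NL, (j, NL j) ∉
        (Finset.univ : Finset (Fin (2 * b) × Fin (2 * b))).filter (fun a => blockEmb (two_mul_le b c) a ∈ I)) := by
    intro NL; simp only [Finset.mem_filter, Finset.mem_univ, true_and]
  have hfR : ∀ NR : Fin (2 * c) → Fin (2 * c), (∀ j ∈ openers NR, blockEmbR b c (j, NR j) ∉ I) ↔
      (∀ j ∈ openers NR, (j, NR j) ∉
        (Finset.univ : Finset (Fin (2 * c) × Fin (2 * c))).filter (fun a => blockEmbR b c a ∈ I)) := by
    intro NR; simp only [Finset.mem_filter, Finset.mem_univ, true_and]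
  obtain ⟨NL, hNL, hNLI⟩ := hL
  obtain ⟨NR, hNR, hNRI⟩ := hR
  have H := complexity_faceL_le I ⟨NL, hNL, (hfL NL).2 hNLI⟩ ⟨NR, hNR, (hfR NR).2 hNRI⟩
  have heq : (∑ NL ∈ (nestFreeMatchings (2 * b)).filter
      (fun NL => ∀ j ∈ openers NL, blockEmb (two_mul_le b c) (j, NL j) ∉ I), arcMonomial ℝ≥0 NL) =
      ∑ NL ∈ (nestFreeMatchings (2 * b)).filter (fun NL => ∀ j ∈ openers NL, (j, NL j) ∉
        (Finset.univ : Finset (Fin (2 * b) × Fin (2 * b))).filter (fun a => blockEmb (two_mul_le b c) a ∈ I)),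
        arcMonomial ℝ≥0 NL :=
    Finset.sum_congr (Finset.filter_congr fun NL _ => hfL NL) fun _ _ => rfl
  rw [heq] at H
  exact H

/-- RIGHT STEP in preimage form. [cite: Burgisser2000, Rem. 2.7] -/
theorem stepR (I : Finset (Fin (2 * (b + c)) × Fin (2 * (b + c))))
    (hL : ∃ NL ∈ nestFreeMatchings (2 * b), ∀ j ∈ openers NL, (j, NL j) ∉
      (Finset.univ : Finset (Fin (2 * b) × Fin (2 * b))).filter (fun a => blockEmb (two_mul_le b c) a ∈ I))
    (hR : ∃ NR ∈ nestFreeMatchings (2 * c), ∀ j ∈ openers NR, (j, NR j) ∉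
      (Finset.univ : Finset (Fin (2 * c) × Fin (2 * c))).filter (fun a => blockEmbR b c a ∈ I)) :
    complexity (∑ NR ∈ (nestFreeMatchings (2 * c)).filter (fun NR => ∀ j ∈ openers NR, (j, NR j) ∉
        (Finset.univ : Finset (Fin (2 * c) × Fin (2 * c))).filter (fun a => blockEmbR b c a ∈ I)),
        arcMonomial ℝ≥0 NR) ≤
      complexity (∑ M ∈ (nestFreeMatchings (2 * (b + c))).filter (fun M => ∀ j ∈ openers M, (j, M j) ∉ I),
        arcMonomial ℝ≥0 M) + 3 := by
  classical
  have hfL : ∀ NL : Fin (2 * b) → Fin (2 * b), (∀ j ∈ openers NL, blockEmb (two_mul_le b c) (j, NL j) ∉ I) ↔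
      (∀ j ∈ openers NL, (j, NL j) ∉
        (Finset.univ : Finset (Fin (2 * b) × Fin (2 * b))).filter (fun a => blockEmb (two_mul_le b c) a ∈ I)) := by
    intro NL; simp only [Finset.mem_filter, Finset.mem_univ, true_and]
  have hfR : ∀ NR : Fin (2 * c) → Fin (2 * c), (∀ j ∈ openers NR, blockEmbR b c (j, NR j) ∉ I) ↔
      (∀ j ∈ openers NR, (j, NR j) ∉
        (Finset.univ : Finset (Fin (2 * c) × Fin (2 * c))).filter (fun a => blockEmbR b c a ∈ I)) := by
    intro NR; simp only [Finset.mem_filter, Finset.mem_univ, true_and]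
  obtain ⟨NL, hNL, hNLI⟩ := hL
  obtain ⟨NR, hNR, hNRI⟩ := hR
  have H := complexity_faceR_le I ⟨NL, hNL, (hfL NL).2 hNLI⟩ ⟨NR, hNR, (hfR NR).2 hNRI⟩
  have heq : (∑ NR ∈ (nestFreeMatchings (2 * c)).filter
      (fun NR => ∀ j ∈ openers NR, blockEmbR b c (j, NR j) ∉ I), arcMonomial ℝ≥0 NR) =
      ∑ NR ∈ (nestFreeMatchings (2 * c)).filter (fun NR => ∀ j ∈ openers NR, (j, NR j) ∉
        (Finset.univ : Finset (Fin (2 * c) × Fin (2 * c))).filter (fun a => blockEmbR b c a ∈ I)),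
        arcMonomial ℝ≥0 NR :=
    Finset.sum_congr (Finset.filter_congr fun NR _ => hfR NR) fun _ _ => rfl
  rw [heq] at H
  exact H

end Blocks

/-! ### §3 The recursion -/

/-- The face avoiding no arc is `NN_n`. [folklore] -/
theorem face_empty (n : ℕ) :
    (∑ M ∈ (nestFreeMatchings (2 * n)).filter (fun M => ∀ j ∈ openers M, (j, M j) ∉
      (∅ : Finset (Fin (2 * n) × Fin (2 * n)))), arcMonomial ℝ≥0 M) = nestFreeMatchingPoly n ℝ≥0 := by
  rw [nestFreeMatchingPoly_eq_sum_arcMonomial, Finset.filter_true_of_mem]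
  intro M _ j _ h
  exact Finset.notMem_empty _ h

/-- ★★ **FACES AVOIDING AT MOST `k` ARBITRARY ARCS ARE HARD.**  For every `k` there are `n₀, C` such that for all `n ≥ n₀` and
every set `I` of at most `k` arc variables of `[0, 2n)` some `m` with `n ≤ C (m + 1)` has `2^{m^{1/6}} ≤ L₊(NN_n^{¬I}) + 3k`.
[cite: HrubesYehudayoff2021, §6 Problem 2] [cite: Burgisser2000, Rem. 2.7] -/
theorem fewArcFaces_exp_lower_bound (k : ℕ) : ∃ n₀ C : ℕ, ∀ n : ℕ, n₀ ≤ n →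
    ∀ I : Finset (Fin (2 * n) × Fin (2 * n)), I.card ≤ k →
    ∃ m : ℕ, n ≤ C * (m + 1) ∧ (2 : ℝ) ^ ((m : ℝ) ^ ((1 : ℝ) / 6)) ≤
      ((complexity (∑ M ∈ (nestFreeMatchings (2 * n)).filter (fun M => ∀ j ∈ openers M, (j, M j) ∉ I),
        arcMonomial ℝ≥0 M) + 3 * k : ℕ) : ℝ) := by
  classical
  obtain ⟨nE, hnE⟩ := NNMonotoneExpBound.exp_lower_bound
  induction k with
  | zero =>
    refine ⟨nE, 1, fun n hn I hI => ⟨n, by omega, ?_⟩⟩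
    obtain rfl : I = ∅ := Finset.card_eq_zero.1 (Nat.le_zero.1 hI)
    rw [face_empty]
    exact (hnE n hn).trans (by exact_mod_cast Nat.le_add_right _ _)
  | succ k ih =>
    obtain ⟨n₀, C, hrec⟩ := ih
    refine ⟨4 * n₀ + 4 * nE + 8 * k + 40, 2 * C + 4 * k + 14, fun n hn I hI => ?_⟩
    -- the size bookkeeping `n ≤ C' (m + 1)`
    have hCm : ∀ m c' : ℕ, c' ≤ C * (m + 1) → n ≤ 2 * c' + (4 * k + 12) → n ≤ (2 * C + 4 * k + 14) * (m + 1) := by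
      intro m c' hm hle
      have e : (2 * C + 4 * k + 14) * (m + 1) = 2 * (C * (m + 1)) + (4 * k + 14) * (m + 1) := by ring
      have e2 : 4 * k + 14 ≤ (4 * k + 14) * (m + 1) := Nat.le_mul_of_pos_right _ (by omega)
      omega
    by_cases hI0 : I = ∅
    · subst hI0
      refine ⟨n, ?_, ?_⟩
      · have e : (2 * C + 4 * k + 14) * (n + 1) = (2 * C + 4 * k) * (n + 1) + 14 * (n + 1) := by ring
        have e2 : 0 ≤ (2 * C + 4 * k) * (n + 1) := Nat.zero_le _
        omega
      · rw [face_empty]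
        exact (hnE n (by omega)).trans (by exact_mod_cast Nat.le_add_right _ _)
    obtain ⟨A, hA⟩ := Finset.nonempty_iff_ne_empty.2 hI0
    by_cases hdeg : (A.2 : ℕ) ≤ (A.1 : ℕ)
    · -- a degenerate pair is never an arc `(j, M j)`, `j < M j`: drop it and use the induction hypothesis at `n`
      have hfeq : (nestFreeMatchings (2 * n)).filter (fun M => ∀ j ∈ openers M, (j, M j) ∉ I) =
          (nestFreeMatchings (2 * n)).filter (fun M => ∀ j ∈ openers M, (j, M j) ∉ I.erase A) := by
        refine Finset.filter_congr fun M _ => ⟨fun h j hj hmem => h j hj (Finset.mem_of_mem_erase hmem),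
          fun h j hj hmem => h j hj (Finset.mem_erase.2 ⟨fun hEq => ?_, hmem⟩)⟩
        have hlt := mem_openers.1 hj
        rw [Fin.lt_def] at hlt
        have h1 := congrArg (fun p : Fin (2 * n) × Fin (2 * n) => ((p.1 : Fin (2 * n)) : ℕ)) hEq
        have h2 := congrArg (fun p : Fin (2 * n) × Fin (2 * n) => ((p.2 : Fin (2 * n)) : ℕ)) hEq
        simp only at h1 h2
        omega
      have hIk : (I.erase A).card ≤ k := by rw [Finset.card_erase_of_mem hA]; omega
      obtain ⟨m, hm, hexp⟩ := hrec n (by omega) (I.erase A) hIk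
      refine ⟨m, ?_, ?_⟩
      · have e : (2 * C + 4 * k + 14) * (m + 1) = 2 * (C * (m + 1)) + (4 * k + 14) * (m + 1) := by ring
        have e2 : 0 ≤ (4 * k + 14) * (m + 1) := Nat.zero_le _
        omega
      · rw [hfeq]
        refine hexp.trans ?_
        exact_mod_cast Nat.add_le_add_left (by omega : 3 * k ≤ 3 * (k + 1)) _
    · push Not at hdeg
      by_cases hcase : n ≤ (A.2 : ℕ)
      · -- keep the LEFT block `[0, 2b)`, `2b ≤ A.2`
        obtain ⟨b, hb⟩ : ∃ b : ℕ, b = min ((A.2 : ℕ) / 2) (n - (2 * k + 5)) := ⟨_, rfl⟩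
        have hA2 := A.2.isLt
        have hb2 : 2 * b ≤ (A.2 : ℕ) := by omega
        have hbn : b ≤ n := by omega
        have hbig : n ≤ 2 * b + (4 * k + 12) := by omega
        have hb0 : n₀ ≤ b := by omega
        have hb3 : 2 * k + 3 ≤ b := by omega
        have hcb : 2 * (k + 1) + 3 ≤ n - b := by omega
        obtain ⟨c, hc⟩ := Nat.exists_eq_add_of_le hbn
        subst hc
        have hc5 : 2 * (k + 1) + 3 ≤ c := by omega
        have hpreL := card_preimageL_le_pred I hA hb2
        have hpreR := card_preimageR_le I
        have hILk : ((Finset.univ : Finset (Fin (2 * b) × Fin (2 * b))).filter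
            (fun a => blockEmb (two_mul_le b c) a ∈ I)).card ≤ k := by omega
        have hIRk := hpreR.trans hI
        have hL := exists_nestFree_avoiding_of_card_le hb3 _ hILk
        have hR := exists_nestFree_avoiding_of_card_le hc5 _ hIRk
        have hstep := stepL I hL hR
        obtain ⟨m, hm, hexp⟩ := hrec b hb0 _ hILk
        refine ⟨m, hCm m b hm hbig, hexp.trans ?_⟩
        have := Nat.add_le_add_right hstep (3 * k)
        exact_mod_cast this.trans (le_of_eq (by ring))
      · -- keep the RIGHT block `[2b, 2n)`, `A.1 < 2b`
        push Not at hcase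
        obtain ⟨b, hb⟩ : ∃ b : ℕ, b = max ((A.1 : ℕ) / 2 + 1) (2 * k + 5) := ⟨_, rfl⟩
        have hb1 : (A.1 : ℕ) < 2 * b := by omega
        have hbn : b ≤ n := by omega
        have hbig : n ≤ 2 * (n - b) + (4 * k + 12) := by omega
        have hb5 : 2 * (k + 1) + 3 ≤ b := by omega
        have hc0 : n₀ ≤ n - b := by omega
        have hc3 : 2 * k + 3 ≤ n - b := by omega
        obtain ⟨c, hc⟩ := Nat.exists_eq_add_of_le hbn
        subst hc
        have hc0' : n₀ ≤ c := by omega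
        have hc3' : 2 * k + 3 ≤ c := by omega
        have hbig' : b + c ≤ 2 * c + (4 * k + 12) := by omega
        have hpreR := card_preimageR_le_pred I hA hb1
        have hpreL := card_preimageL_le I
        have hIRk : ((Finset.univ : Finset (Fin (2 * c) × Fin (2 * c))).filter
            (fun a => blockEmbR b c a ∈ I)).card ≤ k := by omega
        have hILk := hpreL.trans hI
        have hL := exists_nestFree_avoiding_of_card_le hb5 _ hILk
        have hR := exists_nestFree_avoiding_of_card_le hc3' _ hIRk
        have hstep := stepR I hL hR
        obtain ⟨m, hm, hexp⟩ := hrec c hc0' _ hIRk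
        refine ⟨m, hCm m c hm hbig', hexp.trans ?_⟩
        have := Nat.add_le_add_right hstep (3 * k)
        exact_mod_cast this.trans (le_of_eq (by ring))

/-! ### §4 Quasi-polynomial currency and the bounded-arc-set genericity tier -/

/-- `x^K + t ≤ (x + t)^(K + t)` for `x ≥ 1`. [folklore] -/
theorem pow_add_le_pow (x K t : ℕ) (hx : 1 ≤ x) : x ^ K + t ≤ (x + t) ^ (K + t) := by
  rcases Nat.eq_zero_or_pos t with rfl | ht
  · simp
  · have h1 : x ^ K ≤ (x + t) ^ K := Nat.pow_le_pow_left (by omega) K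
    have h2 : 1 ≤ (x + t) ^ K := Nat.one_le_pow _ _ (by omega)
    calc x ^ K + t ≤ (x + t) ^ K + t * (x + t) ^ K := by nlinarith
      _ = (x + t) ^ K * (1 + t) := by ring
      _ ≤ (x + t) ^ K * (x + t) ^ t := by
          apply Nat.mul_le_mul_left
          calc 1 + t ≤ x + t := by omega
            _ = (x + t) ^ 1 := (pow_one _).symm
            _ ≤ (x + t) ^ t := Nat.pow_le_pow_right (by omega) ht
      _ = (x + t) ^ (K + t) := by rw [← pow_add]

/-- ★★ **FEW-ARC FACES, quasi-polynomial currency.**  For every `k, c`, eventually in `n`: for every set `I` of at most `k`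
arcs and every `L`, `L₊(NN_n^{¬I}) ≤ 16 ((2n+1)(L+2))² ⇒ 2^((log₂ n + c)^c) < L`. [cite: HrubesYehudayoff2021, §6 Problem 2] -/
theorem fewArcFaces_qp_hard (k c : ℕ) : ∃ n₀ : ℕ, ∀ n : ℕ, n₀ ≤ n →
    ∀ I : Finset (Fin (2 * n) × Fin (2 * n)), I.card ≤ k → ∀ L : ℕ,
    complexity (∑ M ∈ (nestFreeMatchings (2 * n)).filter (fun M => ∀ j ∈ openers M, (j, M j) ∉ I),
      arcMonomial ℝ≥0 M) ≤ 16 * ((2 * n + 1) * (L + 2)) ^ 2 → 2 ^ ((Nat.log 2 n + c) ^ c) < L := by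
  set K : ℕ := c + 14 with hK
  obtain ⟨n₁, C, hn₁⟩ := fewArcFaces_exp_lower_bound k
  obtain ⟨n₃, hn₃⟩ := polylog_lt_rpow_lin_eventually (K + 3 * k) C
  refine ⟨max n₁ n₃, fun n hn I hI L hface => ?_⟩
  have hnn1 : n₁ ≤ n := le_trans (le_max_left _ _) hn
  have hnn3 : n₃ ≤ n := le_trans (le_max_right _ _) hn
  set F := complexity (∑ M ∈ (nestFreeMatchings (2 * n)).filter (fun M => ∀ j ∈ openers M, (j, M j) ∉ I),
      arcMonomial ℝ≥0 M) with hF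
  by_contra hle
  push Not at hle
  have e1 := absorb_arith n c L hle
  have e3 : 2 ^ (2 * (Nat.log 2 n + c) ^ c + 2 * Nat.log 2 n + 13) ≤ 2 ^ ((Nat.log 2 n + K) ^ K) :=
    Nat.pow_le_pow_right (by norm_num) (absorb_exp (Nat.log 2 n) c)
  have h7 : 16 * ((2 * n + 1) * (L + 2)) ^ 2 + 1 ≤ 2 ^ ((Nat.log 2 n + K) ^ K) := e1.trans e3
  have hp : (Nat.log 2 n + K) ^ K + 3 * k ≤ (Nat.log 2 n + (K + 3 * k)) ^ (K + 3 * k) := by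
    have := pow_add_le_pow (Nat.log 2 n + K) K (3 * k) (by omega)
    rwa [show Nat.log 2 n + K + 3 * k = Nat.log 2 n + (K + 3 * k) by ring] at this
  have h8 : 16 * ((2 * n + 1) * (L + 2)) ^ 2 + 3 * k + 1 ≤ 2 ^ ((Nat.log 2 n + (K + 3 * k)) ^ (K + 3 * k)) := by
    have h3k : 3 * k + 1 ≤ 2 ^ (3 * k) := by
      have := Nat.lt_two_pow_self (n := 3 * k)
      omega
    have hpos : 1 ≤ 2 ^ ((Nat.log 2 n + K) ^ K) := Nat.one_le_two_pow
    calc 16 * ((2 * n + 1) * (L + 2)) ^ 2 + 3 * k + 1 ≤ 2 ^ ((Nat.log 2 n + K) ^ K) + 3 * k := by omega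
      _ ≤ 2 ^ ((Nat.log 2 n + K) ^ K) * (3 * k + 1) := by nlinarith
      _ ≤ 2 ^ ((Nat.log 2 n + K) ^ K) * 2 ^ (3 * k) := Nat.mul_le_mul_left _ h3k
      _ = 2 ^ ((Nat.log 2 n + K) ^ K + 3 * k) := by rw [← pow_add]
      _ ≤ 2 ^ ((Nat.log 2 n + (K + 3 * k)) ^ (K + 3 * k)) := Nat.pow_le_pow_right (by norm_num) hp
  obtain ⟨m, hm, hexp⟩ := hn₁ n hnn1 I hI
  have h2 := hn₃ n hnn3 m hm
  have h3 : (2 : ℝ) ^ ((((Nat.log 2 n + (K + 3 * k)) ^ (K + 3 * k) : ℕ) : ℝ)) < (2 : ℝ) ^ ((m : ℝ) ^ ((1 : ℝ) / 6)) :=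
    Real.rpow_lt_rpow_of_exponent_lt (by norm_num) h2
  have h4 : ((2 ^ ((Nat.log 2 n + (K + 3 * k)) ^ (K + 3 * k)) : ℕ) : ℝ) < ((F + 3 * k : ℕ) : ℝ) := by
    rw [Nat.cast_pow, Nat.cast_ofNat, ← Real.rpow_natCast]
    exact h3.trans_le hexp
  have h5 : 2 ^ ((Nat.log 2 n + (K + 3 * k)) ^ (K + 3 * k)) < F + 3 * k := by exact_mod_cast h4
  have h9 : F + 3 * k < 16 * ((2 * n + 1) * (L + 2)) ^ 2 + 3 * k + 1 := by omega
  exact absurd (lt_trans h5 (lt_of_lt_of_le h9 h8)) (lt_irrefl _)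

/-- ★★ **COFACTORS GENERIC FOR SOME BOUNDED ARC SET ARE NOT CERTIFICATES.**  For every `k, c`, eventually in `n`: if for
some set `I` of at most `k` arc variables the outer face `top_{𝟙_{I^c}} h` of the cofactor `h` is a single monomial `a · x^d`
(`a ≠ 0`), then `2^((log₂ n + c)^c) < L₊(NN_n · h) + L₊(h)`. [cite: HrubesYehudayoff2021, §6 Problem 2]
[cite: JuknaSeiwertSergeev2022, Thm 1] -/
theorem fewArcsGeneric_not_certificate_qp (k c : ℕ) : ∃ n₀ : ℕ, ∀ n : ℕ, n₀ ≤ n →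
    ∀ I : Finset (Fin (2 * n) × Fin (2 * n)), I.card ≤ k →
    ∀ (h : MvPolynomial (Fin (2 * n) × Fin (2 * n)) ℝ≥0) (d : (Fin (2 * n) × Fin (2 * n)) →₀ ℕ) (a : ℝ≥0), a ≠ 0 →
      topComponent (fun v : Fin (2 * n) × Fin (2 * n) => if v ∈ I then 0 else 1) h = monomial d a →
      2 ^ ((Nat.log 2 n + c) ^ c) < complexity (nestFreeMatchingPoly n ℝ≥0 * h) + complexity h := by
  obtain ⟨n₀, hn₀⟩ := fewArcFaces_qp_hard k c
  refine ⟨max n₀ (2 * k + 3), fun n hn I hI h d a ha htop => ?_⟩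
  have hIav := exists_nestFree_avoiding_of_card_le (k := k) (c := n) (le_trans (le_max_right _ _) hn) I hI
  have hface := complexity_avoidingFace_le_of_top_monomial I hIav ha htop
  exact lt_of_lt_of_le (hn₀ n (le_trans (le_max_left _ _) hn) I hI _ hface) (Nat.le_add_right _ _)

end Summit.ValiantsHypothesis.ValiantsHypothesis.Theorems.FifoMatching.NNDivisionHard.FewArcFaces

end
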